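import Summits.HubbardSuperconductivity.HubbardSuperconductivity.Theorems.AnisotropyChordTransferFibre3FinX3Eval

/-!
# Route `AnisotropyChord` / H0 rotor rung: FIN per-`L` GM₃ (X5), `L = 26` — rows `N₁` / D / side-condition cell facts, part `p08`

Kernel facts (`decide +kernel`) for cert cells 35, 36 of the per-`L` grid of `L = 26`: `xbnCellAny2` (row `N₁` on XB2 point wedges recomputed in the kernel, exporting the literal brackets `nt ⊇ T⁺ − 3λ₂` and `tb ⊇ T⁺·D`), `xdCellAnyN0` (row D, reads `nt`), `sdCellAnyZN` (side condition, reads `nt`); evaluators `…FinX3Eval` / `…FinX5Eval`; constants from the compiled design probe (x3probe/x3plan, margins c ×0.985, b ×1.03, aD ×1.03); assembled in `…FinX5GM3TwentySix`.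
Prover seat `hubbard-h0-rotor-p3` g8; helper for piece A = stmt-HubbardSuperconductivity-23918 of rung 19089 (`--supports`, helper class).
WHAT THIS IS NOT: nothing here proves superconductivity in the Hubbard model (rotor TARGET as worded stays FALSE, g15 verdict); kernel facts for the FIN certificate of ONE conditional reduction.  Tree imports only; zero data; standard axioms.
-/

set_option linter.dupNamespace false
set_option autoImplicit false

namespace Summit.HubbardSuperconductivity.HubbardSuperconductivity.Theorems.AnisotropyChord.Transfer.Fibre3

namespace FinXD

open FinXB FinCell Hole2

set_option maxHeartbeats 4000000 in
/-- row `N₁` of cell 35 of `L = 26` (`c = 119/200`), exporting `nt`, `tb`. [folklore] -/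
theorem xn26_35 : xbnCellAny2 26 (49/50 : ℚ) 187780710735236 192475228503617 (119/200 : ℚ) ((-3523122211588 : ℤ), (3531710329530 : ℤ)) ((559815571626614 : ℤ), (580960834207887 : ℤ)) = true := by decide +kernel

set_option maxHeartbeats 4000000 in
/-- row D of cell 35 of `L = 26` (`aD = 83/1000`). [folklore] -/
theorem xd26_35 : xdCellAnyN0 26 (49/50 : ℚ) 187780710735236 192475228503617 (83/1000 : ℚ) ((-3523122211588 : ℤ), (3531710329530 : ℤ)) = true := by decide +kernel

set_option maxHeartbeats 4000000 in
/-- side condition of cell 35 of `L = 26` (`c, b = 58/100, aD`). [folklore] -/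
theorem sd26_35 : sdCellAnyZN 26 (49/50 : ℚ) 100 187780710735236 192475228503617 ((119/200 : ℚ), (58 : ℕ), (83/1000 : ℚ)) ((-3523122211588 : ℤ), (3531710329530 : ℤ)) = true := by decide +kernel

set_option maxHeartbeats 4000000 in
/-- row `N₁` of cell 36 of `L = 26` (`c = 119/200`), exporting `nt`, `tb`. [folklore] -/
theorem xn26_36 : xbnCellAny2 26 (49/50 : ℚ) 192475228503617 197287109216208 (119/200 : ℚ) ((-3508929019847 : ℤ), (3531249763127 : ℤ)) ((573913232164311 : ℤ), (595396101738444 : ℤ)) = true := by decide +kernel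

set_option maxHeartbeats 4000000 in
/-- row D of cell 36 of `L = 26` (`aD = 83/1000`). [folklore] -/
theorem xd26_36 : xdCellAnyN0 26 (49/50 : ℚ) 192475228503617 197287109216208 (83/1000 : ℚ) ((-3508929019847 : ℤ), (3531249763127 : ℤ)) = true := by decide +kernel

set_option maxHeartbeats 4000000 in
/-- side condition of cell 36 of `L = 26` (`c, b = 58/100, aD`). [folklore] -/
theorem sd26_36 : sdCellAnyZN 26 (49/50 : ℚ) 100 192475228503617 197287109216208 ((119/200 : ℚ), (58 : ℕ), (83/1000 : ℚ)) ((-3508929019847 : ℤ), (3531249763127 : ℤ)) = true := by decide +kernel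

end FinXD

end Summit.HubbardSuperconductivity.HubbardSuperconductivity.Theorems.AnisotropyChord.Transfer.Fibre3
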